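import Summits.NavierStokesRegularity.NavierStokesRegularity.Theorems.ExtremiserTransienceNearExtremalTransiencePerFlowOfPorousZone
import Summits.NavierStokesRegularity.NavierStokesRegularity.Theorems.ExtremiserTransienceTransienceExitViolatorWindows
import Summits.NavierStokesRegularity.NavierStokesRegularity.Theorems.ExtremiserTransienceTransienceExitForwardGapCovering
import HarnessLib

/-!
# Crux `NearExtremalTransiencePerFlow` (stmt-NavierStokesRegularity-26567), LINE g12-α «transience-exit» (ns-idea-5 g12)

NO SUMMIT IS PROVED BY A LINE.  This is a checked skeleton for the rank-2 crux of route `ExtremiserTransience`; it bears on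
LADDER-NS rung «ExtremiserTransience / NearExtremalTransiencePerFlow ⟨26567⟩» and on nothing above it.  The heart X below, the
crux and NS regularity remain OPEN.

TECHNIQUE CARD «extremal-example mining», applied to the route's OWN founding examples: every known near-maximiser of the
vortex-stretching/depletion quotient (Lu–Doering optimal enstrophy-growth states, Ayala–Protas extreme vortex states, Kang–Yun–Protas
maximum amplification, and the instrument crystals of g11 `inst/MINED_g11.md`) is TRANSIENT under Navier–Stokes: the maximal
instantaneous efficiency is never sustained for a turnover.  Seventeen lines on this crux type that fact STATICALLY (extremal / tight /
crystalline / chain / crowding limits + a Liouville or ledger kill); none types the DYNAMIC EXIT itself.  This line does: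

* **X `NearExtremalExit` (HEART, the only open mathematics of the line).**  A universal SHORT-TIME law for classical Leray–Hopf flows
  from rapidly decaying data (no blow-up, no Type-I assumption, no violator): if the slice `u(t)` is strictly `(κ⋆−δ)`-efficient at its
  height bound `M` (`(κ⋆−δ)·M·‖ω‖₂‖∇ω‖₂ < |∫ω·Sω|`), Taylor-LOCKED (`Z ≤ Θ(ν/M)²P`), with gradient `‖∇u(t)‖_∞ ≤ G·M²/ν`, and the heights stay
  `≤ H·M` on the next `2τ₁` height-time units `ν/M²`, then on the DELAYED window `[t + τ₁ν/M², t + 2τ₁ν/M²]` the flow-wise clause holds with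
  the DEFINITE deficit `κ⋆ − ε`: `|∫ω·Sω| ≤ (κ⋆−ε)·M'·‖ω‖₂‖∇ω‖₂` for every height bound `M'`.  Quantifiers: `∀ Θ G H ∃ τ₀ ∀ τ₁ ≤ τ₀ ∃ δ ε`
  (second-order transience: `δ ≍ ε ≍ τ₁²·(uniform transversality of the NS vector field to the near-extremal set)`).
* **W `ViolatorWindows` (flow side, PROVABLE from landed theorems, M).**  A violator carries a measurable coefficient `k` with the
  strict-efficiency read-back of p620874, and for every level `κ⋆/2 ≤ m < κ⋆`, every `η > 0` and every `L` a late window `[t₁,t]` of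
  log-length `ℓ ≥ L` on which the INEFFICIENT set `{k ≤ m}` has log-measure `≤ ηℓ` (full upper log-density of efficient times,
  `efficientTimes_logDensity_of_not_perFlow`) and a measurable set `S ⊆ [t₁,t]` of LOCKED `m`-efficient times of log-measure `≥ dℓ`
  (`lockedTimes_logDensity`, `d = d₀/2`), each point of which comes with an X-ready height package (Leray's lower rate
  `lerayLowerRate_of_not_extends`, the Type-I rate, `gradTypeIRate_of_typeIRate`: `c_lo ν ≤ M²(T−τ) ≤ c_hi ν`, lock `Z ≤ Θ(ν/M)²P`,
  gradient `≤ G M²/ν`, heights `≤ H M` on `[τ, τ + c_w ν/M²] ⊂ [0,T)`).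
* **G `ForwardGapCovering` (pure real analysis, PROVABLE, M).**  One-sided Vitali covering in log-time: if every point `t'` of
  `S ⊆ [t₁,t]` kills a forward window `[t' + a(T−t'), t' + 2a(T−t')] ⊆ F` (`a ∈ [a₁,a₂] ⊂ (0,½)`, `S ∩ F = ∅`), then
  `c·μ(S) ≤ μ(F ∩ [t₁,t]) + C₀` for the log-measures `μ = ∫ 1/(T−τ)dτ` (`c = β/(α+β)`, `β = log((1−a₁)/(1−2a₁))`, `α = −log(1−a₂)`).
* **Skeleton** (kernel-checked, ONE theorem concluding the crux BY NAME): violator frame → W → X turns every point of `S` into a killed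
  forward window inside `{k ≤ m}` (`m = κ⋆ − min(δ, ε, κ⋆/2)`) → G: `c·dℓ ≤ ηℓ + C₀` → with `η = cd/2`, `L = 2C₀/(cd) + 1`: `ℓ < L ≤ ℓ`.

Why novel vs the listed lines (levers in five words): g4–g11 and ns-idea-10 levers are «extremal tangent slice + Liouville» (tangent,
constant_speed, two_peak, nodal, bangbang_core, regularised_transfer), «analytic DSS gap» (analytic_gap), «zone sojourn + descent»
(zone_transversality: the only other TIME-SET line — its porosity comes from per-violator sojourn/descent bounds Z1/Z2⁻ on `k₀`, the latter
containing the crux-sized upper lock; HERE porosity comes from a FLOW-UNIVERSAL exit law that needs the lock only AT the efficient instant,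
where `lockedTimes_logDensity` supplies it for free), «filament gap / chain gap / crowding + energy ledger» (filament_gap, filament_selection,
dissipation_ledger, tight_or_chain, multiscale_crowding), «tight + quarter law / symmetry germ» (leray_pincer, symmetry_harvest), «local
maximiser + thick good centre» (local_maximiser).  Lever here: «near-extremal states exit within a turnover».

INSTRUMENT ROW (founding falsifier (d) of the seat, first run g12): TRANSIENCE — evolve the g11 crystal `inst/fields/j329361_N96_sup5_r0_R0.14089.npz`
under periodic pseudo-spectral NS at 2–3 Reynolds numbers and read `R(t)` per turnover; prereg (frozen before submit, `inst/PREREG_transience.md`):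
EXIT iff `R(τ) ≤ R(0) − 0.02` throughout `[1, 2]` turnovers at every Re; PERSIST (X disfavoured) iff `R(τ) ≥ R(0) − 0.005` up to 3 turnovers at some Re.

HONEST FRAMING: X is a conjecture about short-time Navier–Stokes dynamics near the (unknown) maximisers of the depletion quotient; W and G are
bookkeeping/real-analysis statements believed provable from the tree; nothing about Navier–Stokes regularity or blow-up is proved here.
[folklore]
-/

noncomputable section

open scoped Topology InnerProductSpace RealInnerProductSpace ENNReal ContDiff
open MeasureTheory Filter Set Metric
open Literature.Analysis.FluidPDE
open Summit.NavierStokesRegularity.NavierStokesRegularity.Theses.ExtremiserTransience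
open Summit.NavierStokesRegularity.NavierStokesRegularity.Theorems
open Summit.NavierStokesRegularity.NavierStokesRegularity.Theorems.DepletionLadder.KStar.HalfSpace
open Summit.NavierStokesRegularity.NavierStokesRegularity.Theorems.NearExtremalTransiencePerFlow.ZoneTransversality

namespace Summit.NavierStokesRegularity.NavierStokesRegularity.Cruxes.NearExtremalTransiencePerFlow.TransienceExit

-- the summit's namespace repeats the problem name by convention (D-0017)
set_option linter.dupNamespace false
set_option linter.style.longLine false

/-! ## §1 The three statements -/

/-- **X — NEAR-EXTREMAL EXIT (HEART, OPEN).**  For classical Leray–Hopf flows from rapidly decaying data on `[0,T) × ℝ³` (any `ν, T`):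
a strictly `(κ⋆−δ)`-efficient, Taylor-locked slice at time `t` with height bound `M`, gradient `≤ G M²/ν` and heights `≤ H M` on
`[t, t + 2τ₁ν/M²]` is followed, on the delayed window `[t + τ₁ν/M², t + 2τ₁ν/M²]`, by slices obeying the flow-wise depletion clause
with coefficient `κ⋆ − ε` at every height bound.  `∀ Θ G H > 0 ∃ τ₀ > 0 ∀ τ₁ ∈ (0,τ₀] ∃ δ ε > 0`. -/
def NearExtremalExit : Prop :=
  ∀ (Θ G H : ℝ), 0 < Θ → 0 < G → 0 < H → ∃ τ₀ : ℝ, 0 < τ₀ ∧ ∀ τ₁ : ℝ, 0 < τ₁ → τ₁ ≤ τ₀ →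
    ∃ δ ε : ℝ, 0 < δ ∧ 0 < ε ∧
    ∀ (ν T : ℝ), 0 < ν → 0 < T →
    ∀ (u : ℝ → EuclideanSpace ℝ (Fin 3) → EuclideanSpace ℝ (Fin 3)) (p : ℝ → EuclideanSpace ℝ (Fin 3) → ℝ),
      IsClassicalNSSolutionOn (Set.Ico 0 T) ν 0 u p → IsLerayHopfOn T ν 0 (u 0) u → HasRapidSpatialDecay (u 0) →
    ∀ (t M : ℝ), 0 ≤ t → 0 < M → t + 2 * τ₁ * ν / M ^ 2 < T →
      (∀ x, ‖u t x‖ ≤ M) →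
      (kStar - δ) * M * Real.sqrt (∫ x, ‖curl (u t) x‖ ^ 2) * Real.sqrt (∫ x, frobeniusNormSq (fderiv ℝ (curl (u t)) x)) <
        |∫ x, ⟪curl (u t) x, fderiv ℝ (u t) x (curl (u t) x)⟫_ℝ| →
      (∫ x, ‖curl (u t) x‖ ^ 2) ≤ Θ * (ν / M) ^ 2 * (∫ x, frobeniusNormSq (fderiv ℝ (curl (u t)) x)) →
      (∀ x, ‖fderiv ℝ (u t) x‖ ≤ G * M ^ 2 / ν) →
      (∀ t' ∈ Set.Icc t (t + 2 * τ₁ * ν / M ^ 2), ∀ x, ‖u t' x‖ ≤ H * M) →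
    ∀ t' ∈ Set.Icc (t + τ₁ * ν / M ^ 2) (t + 2 * τ₁ * ν / M ^ 2), ∀ M' : ℝ, (∀ x, ‖u t' x‖ ≤ M') →
      |∫ x, ⟪curl (u t') x, fderiv ℝ (u t') x (curl (u t') x)⟫_ℝ| ≤
        (kStar - ε) * M' * Real.sqrt (∫ x, ‖curl (u t') x‖ ^ 2) * Real.sqrt (∫ x, frobeniusNormSq (fderiv ℝ (curl (u t')) x))

/-- **W — VIOLATOR WINDOWS (flow side, PROVABLE from the landed log-density theorems and rates).**  See the module docstring. -/
def ViolatorWindows : Prop :=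
  ∀ (C ν T : ℝ) (u : ℝ → EuclideanSpace ℝ (Fin 3) → EuclideanSpace ℝ (Fin 3)) (p : ℝ → EuclideanSpace ℝ (Fin 3) → ℝ),
    IsViolator C ν T u p →
    ∃ (k : ℝ → ℝ) (Θ G H c_w c_lo c_hi d : ℝ), Measurable k ∧ (∀ τ, 0 ≤ k τ ∧ k τ ≤ 1) ∧
      (∀ t ∈ Set.Ico 0 T, ∀ m : ℝ, 0 ≤ m → m < k t → ∃ M : ℝ, (∀ x, ‖u t x‖ ≤ M) ∧
        m * M * Real.sqrt (∫ x, ‖curl (u t) x‖ ^ 2) * Real.sqrt (∫ x, frobeniusNormSq (fderiv ℝ (curl (u t)) x)) <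
          |∫ x, ⟪curl (u t) x, fderiv ℝ (u t) x (curl (u t) x)⟫_ℝ|) ∧
      0 < Θ ∧ 0 < G ∧ 0 < H ∧ 0 < c_w ∧ 0 < c_lo ∧ c_lo ≤ c_hi ∧ 0 < d ∧
      ∀ m : ℝ, kStar / 2 ≤ m → m < kStar → ∀ η : ℝ, 0 < η → ∀ L : ℝ,
        ∃ t₁ t : ℝ, 0 ≤ t₁ ∧ t₁ < t ∧ t < T ∧ L ≤ Real.log ((T - t₁) / (T - t)) ∧
          (∫ τ in t₁..t, Set.indicator {σ : ℝ | k σ ≤ m} (fun _ => (1 : ℝ)) τ / (T - τ)) ≤ η * Real.log ((T - t₁) / (T - t)) ∧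
          ∃ S : Set ℝ, MeasurableSet S ∧ S ⊆ Set.Icc t₁ t ∧
            d * Real.log ((T - t₁) / (T - t)) ≤ (∫ τ in t₁..t, Set.indicator S (fun _ => (1 : ℝ)) τ / (T - τ)) ∧
            ∀ τ ∈ S, m < k τ ∧ ∃ M : ℝ, 0 < M ∧ (∀ x, ‖u τ x‖ ≤ M) ∧
              m * M * Real.sqrt (∫ x, ‖curl (u τ) x‖ ^ 2) * Real.sqrt (∫ x, frobeniusNormSq (fderiv ℝ (curl (u τ)) x)) <
                |∫ x, ⟪curl (u τ) x, fderiv ℝ (u τ) x (curl (u τ) x)⟫_ℝ| ∧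
              (∫ x, ‖curl (u τ) x‖ ^ 2) ≤ Θ * (ν / M) ^ 2 * (∫ x, frobeniusNormSq (fderiv ℝ (curl (u τ)) x)) ∧
              (∀ x, ‖fderiv ℝ (u τ) x‖ ≤ G * M ^ 2 / ν) ∧
              c_lo * ν ≤ M ^ 2 * (T - τ) ∧ M ^ 2 * (T - τ) ≤ c_hi * ν ∧
              τ + c_w * ν / M ^ 2 < T ∧
              (∀ t' ∈ Set.Icc τ (τ + c_w * ν / M ^ 2), ∀ x, ‖u t' x‖ ≤ H * M)

/-- **G — FORWARD-GAP COVERING LEMMA (pure real analysis, PROVABLE).**  See the module docstring. -/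
def ForwardGapCovering : Prop :=
  ∀ a₁ a₂ : ℝ, 0 < a₁ → a₁ ≤ a₂ → a₂ < 1 / 2 → ∃ c C₀ : ℝ, 0 < c ∧ 0 ≤ C₀ ∧
    ∀ (T t₁ t : ℝ) (S F : Set ℝ), t₁ ≤ t → t < T → MeasurableSet S → MeasurableSet F → S ⊆ Set.Icc t₁ t → Disjoint S F →
      (∀ t' ∈ S, ∃ a : ℝ, a₁ ≤ a ∧ a ≤ a₂ ∧ ∀ t'' : ℝ, t' + a * (T - t') ≤ t'' → t'' ≤ t' + 2 * a * (T - t') → t'' ∈ F) →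
      c * (∫ τ in t₁..t, Set.indicator S (fun _ => (1 : ℝ)) τ / (T - τ)) ≤
        (∫ τ in t₁..t, Set.indicator F (fun _ => (1 : ℝ)) τ / (T - τ)) + C₀

/-! ## §2 Registered stubs — rev 2: W and G are CLOSED by the landed theorems; the ONLY `sorry` of the file is the heart X -/

/-- HEART (XL, open): near-extremal exit. -/
theorem stub_nearExtremalExit : NearExtremalExit := by
  sorry

/-- Flow side (M) — ★ LANDED (rev 2): p719235 `violatorWindows_holds` (ns-net-p2 g11), whose type is the texts-of-record copy
`Theorems.NearExtremalTransiencePerFlow.TransienceExit.ViolatorWindows` (p718677) = this file's `ViolatorWindows` VERBATIM (closed by `δ`-unfolding). -/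
theorem stub_violatorWindows : ViolatorWindows :=
  Summit.NavierStokesRegularity.NavierStokesRegularity.Theorems.NearExtremalTransiencePerFlow.TransienceExit.violatorWindows_holds

/-- Pure real analysis (M) — ★ LANDED (rev 2): p718391 `forwardGapCovering_holds` (ns-net-p1 g15), type = the body of `ForwardGapCovering` VERBATIM. -/
theorem stub_forwardGapCovering : ForwardGapCovering :=
  Summit.NavierStokesRegularity.NavierStokesRegularity.Theorems.NearExtremalTransiencePerFlow.TransienceExit.forwardGapCovering_holds

namespace Registered

/-- = `NearExtremalExit`. -/
abbrev stub_nearExtremalExit : Prop := NearExtremalExit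
/-- = `ViolatorWindows`. -/
abbrev stub_violatorWindows : Prop := ViolatorWindows
/-- = `ForwardGapCovering`. -/
abbrev stub_forwardGapCovering : Prop := ForwardGapCovering

end Registered

/-! ## §3 THE SKELETON: W + X + G ⇒ the crux BY NAME (no `sorry` outside the three stubs) -/

/-- **LINE g12-α SKELETON.**  Violator frame by contradiction → W (windows, locked efficient set `S`, X-ready height packages) →
X at each point of `S` kills the forward window `[τ + τ₁ν/M², τ + 2τ₁ν/M²] = [τ + a(T−τ), τ + 2a(T−τ)]`, `a = τ₁ν/(M²(T−τ)) ∈ [τ₁/c_hi, τ₁/c_lo]`,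
into the inefficient set `{k ≤ m}` → G: `c·dℓ ≤ ηℓ + C₀` → contradiction for `η = cd/2`, `ℓ ≥ L = 2C₀/(cd) + 1`. -/
theorem NearExtremalTransiencePerFlow_of
    (hX : Registered.stub_nearExtremalExit) :
    NearExtremalTransiencePerFlow := by
  -- rev 2: W and G are no longer hypotheses — they are the landed theorems (closed by name above).
  have hW : Registered.stub_violatorWindows := stub_violatorWindows
  have hG : Registered.stub_forwardGapCovering := stub_forwardGapCovering
  intro C ν T hC hν hT u p hsol hLH hdec hrate hsing
  by_contra hno
  have hV : IsViolator C ν T u p := ⟨hC, hν, hT, hsol, hLH, hdec, hrate, hsing, hno⟩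
  obtain ⟨k, Θ, G, H, c_w, c_lo, c_hi, d, hkm, hk01, hkeff, hΘ, hGpos, hH, hcw, hclo, hlohi, hd, hwin⟩ := hW C ν T u p hV
  have hchi : 0 < c_hi := hclo.trans_le hlohi
  -- X's constants
  obtain ⟨τ₀, hτ₀, hX1⟩ := hX Θ G H hΘ hGpos hH
  obtain ⟨τ₁, hτ₁def⟩ : ∃ τ₁ : ℝ, τ₁ = min τ₀ (min (c_w / 2) (c_lo / 4)) := ⟨_, rfl⟩
  have hτ₁pos : 0 < τ₁ := by rw [hτ₁def]; exact lt_min hτ₀ (lt_min (by linarith) (by linarith))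
  have hτ₁τ₀ : τ₁ ≤ τ₀ := by rw [hτ₁def]; exact min_le_left _ _
  have hτ₁cw : 2 * τ₁ ≤ c_w := by
    have : τ₁ ≤ c_w / 2 := by rw [hτ₁def]; exact (min_le_right _ _).trans (min_le_left _ _)
    linarith
  have hτ₁clo : τ₁ ≤ c_lo / 4 := by rw [hτ₁def]; exact (min_le_right _ _).trans (min_le_right _ _)
  obtain ⟨δ, ε, hδ, hε, hX2⟩ := hX1 τ₁ hτ₁pos hτ₁τ₀
  -- the level `m = κ⋆ − μ₀`, `μ₀ = min(δ, ε, κ⋆/2)`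
  have hK : 0 < kStar := kStar_pos
  obtain ⟨μ₀, hμ₀def⟩ : ∃ μ₀ : ℝ, μ₀ = min (min δ ε) (kStar / 2) := ⟨_, rfl⟩
  have hμ₀pos : 0 < μ₀ := by rw [hμ₀def]; exact lt_min (lt_min hδ hε) (by linarith)
  have hμ₀δ : μ₀ ≤ δ := by rw [hμ₀def]; exact (min_le_left _ _).trans (min_le_left _ _)
  have hμ₀ε : μ₀ ≤ ε := by rw [hμ₀def]; exact (min_le_left _ _).trans (min_le_right _ _)
  have hμ₀K : μ₀ ≤ kStar / 2 := by rw [hμ₀def]; exact min_le_right _ _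
  obtain ⟨m, hmdef⟩ : ∃ m : ℝ, m = kStar - μ₀ := ⟨_, rfl⟩
  have hm_lo : kStar / 2 ≤ m := by linarith
  have hm_lt : m < kStar := by linarith
  have hm0 : 0 ≤ m := by linarith
  have hmδ : kStar - δ ≤ m := by linarith
  have hmε : kStar - ε ≤ m := by linarith
  -- G's constants at `a₁ = τ₁/c_hi`, `a₂ = τ₁/c_lo`
  have ha₁pos : 0 < τ₁ / c_hi := div_pos hτ₁pos hchi
  have ha₁₂ : τ₁ / c_hi ≤ τ₁ / c_lo := div_le_div_of_nonneg_left hτ₁pos.le hclo hlohi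
  have ha₂half : τ₁ / c_lo < 1 / 2 := by
    rw [div_lt_iff₀ hclo]
    linarith
  obtain ⟨c, C₀, hc, hC₀, hGap⟩ := hG (τ₁ / c_hi) (τ₁ / c_lo) ha₁pos ha₁₂ ha₂half
  have hcd : 0 < c * d := mul_pos hc hd
  -- the window (`η = cd/2`, `L = 2C₀/(cd) + 1`)
  have hη : 0 < c * d / 2 := by positivity
  obtain ⟨t₁, t, ht₁0, ht₁t, htT, hL, hEc, S, hSm, hSsub, hSd, hSprop⟩ :=
    hwin m hm_lo hm_lt (c * d / 2) hη (2 * C₀ / (c * d) + 1)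
  -- the inefficient set `F = {k ≤ m}`
  have hFm : MeasurableSet {σ : ℝ | k σ ≤ m} := measurableSet_le hkm measurable_const
  have hSF : Disjoint S {σ : ℝ | k σ ≤ m} := by
    rw [Set.disjoint_left]
    intro σ hσS hσF
    have h1 : m < k σ := (hSprop σ hσS).1
    have h2 : k σ ≤ m := hσF
    linarith
  -- every point of `S` kills a forward window inside `F` (this is where X acts)
  have hkill : ∀ t' ∈ S, ∃ a : ℝ, τ₁ / c_hi ≤ a ∧ a ≤ τ₁ / c_lo ∧
      ∀ t'' : ℝ, t' + a * (T - t') ≤ t'' → t'' ≤ t' + 2 * a * (T - t') → t'' ∈ {σ : ℝ | k σ ≤ m} := by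
    intro t' ht'S
    obtain ⟨hkt', M, hM0, hMb, hstr, hlock, hgrad, hlo, hhi, hwT, hwin'⟩ := hSprop t' ht'S
    have ht'T : t' < T := lt_of_le_of_lt (hSsub ht'S).2 htT
    have ht'0 : 0 ≤ t' := ht₁0.trans (hSsub ht'S).1
    have hTt' : 0 < T - t' := sub_pos.2 ht'T
    have hM2 : 0 < M ^ 2 := by positivity
    have hden : 0 < M ^ 2 * (T - t') := mul_pos hM2 hTt'
    have hM2ne : M ^ 2 ≠ 0 := hM2.ne'
    have hTne : T - t' ≠ 0 := hTt'.ne'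
    have haT : τ₁ * ν / (M ^ 2 * (T - t')) * (T - t') = τ₁ * ν / M ^ 2 := by
      field_simp
    refine ⟨τ₁ * ν / (M ^ 2 * (T - t')), ?_, ?_, ?_⟩
    · -- `τ₁/c_hi ≤ τ₁ν/(M²(T−t'))` from `M²(T−t') ≤ c_hi ν`
      rw [div_le_div_iff₀ hchi hden]
      calc τ₁ * (M ^ 2 * (T - t')) ≤ τ₁ * (c_hi * ν) := mul_le_mul_of_nonneg_left hhi hτ₁pos.le
        _ = τ₁ * ν * c_hi := by ring
    · -- `τ₁ν/(M²(T−t')) ≤ τ₁/c_lo` from `c_lo ν ≤ M²(T−t')`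
      rw [div_le_div_iff₀ hden hclo]
      calc τ₁ * ν * c_lo = τ₁ * (c_lo * ν) := by ring
        _ ≤ τ₁ * (M ^ 2 * (T - t')) := mul_le_mul_of_nonneg_left hlo hτ₁pos.le
    · intro t'' h1 h2
      rw [haT] at h1
      have h2' : t'' ≤ t' + 2 * τ₁ * ν / M ^ 2 := by
        have e : 2 * (τ₁ * ν / (M ^ 2 * (T - t'))) * (T - t') = 2 * τ₁ * ν / M ^ 2 := by
          rw [mul_assoc, haT]
          ring
        linarith [e]
      -- the window `[t', t' + 2τ₁ν/M²]` lies inside `[t', t' + c_w ν/M²] ⊂ [0,T)`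
      have hwin2 : 2 * τ₁ * ν / M ^ 2 ≤ c_w * ν / M ^ 2 :=
        div_le_div_of_nonneg_right (mul_le_mul_of_nonneg_right hτ₁cw hν.le) hM2.le
      have hT2 : t' + 2 * τ₁ * ν / M ^ 2 < T := by linarith
      have hheights : ∀ s ∈ Set.Icc t' (t' + 2 * τ₁ * ν / M ^ 2), ∀ x, ‖u s x‖ ≤ H * M :=
        fun s hs x => hwin' s ⟨hs.1, hs.2.trans (by linarith)⟩ x
      have hstr' : (kStar - δ) * M * Real.sqrt (∫ x, ‖curl (u t') x‖ ^ 2) *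
          Real.sqrt (∫ x, frobeniusNormSq (fderiv ℝ (curl (u t')) x)) <
          |∫ x, ⟪curl (u t') x, fderiv ℝ (u t') x (curl (u t') x)⟫_ℝ| := by
        have hP : 0 ≤ M * Real.sqrt (∫ x, ‖curl (u t') x‖ ^ 2) *
            Real.sqrt (∫ x, frobeniusNormSq (fderiv ℝ (curl (u t')) x)) := by positivity
        have key : (kStar - δ) * M * Real.sqrt (∫ x, ‖curl (u t') x‖ ^ 2) *
            Real.sqrt (∫ x, frobeniusNormSq (fderiv ℝ (curl (u t')) x)) ≤
            m * M * Real.sqrt (∫ x, ‖curl (u t') x‖ ^ 2) *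
            Real.sqrt (∫ x, frobeniusNormSq (fderiv ℝ (curl (u t')) x)) := by
          have h := mul_le_mul_of_nonneg_right hmδ hP
          calc (kStar - δ) * M * Real.sqrt (∫ x, ‖curl (u t') x‖ ^ 2) *
                Real.sqrt (∫ x, frobeniusNormSq (fderiv ℝ (curl (u t')) x))
              = (kStar - δ) * (M * Real.sqrt (∫ x, ‖curl (u t') x‖ ^ 2) *
                Real.sqrt (∫ x, frobeniusNormSq (fderiv ℝ (curl (u t')) x))) := by ring
            _ ≤ m * (M * Real.sqrt (∫ x, ‖curl (u t') x‖ ^ 2) *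
                Real.sqrt (∫ x, frobeniusNormSq (fderiv ℝ (curl (u t')) x))) := h
            _ = m * M * Real.sqrt (∫ x, ‖curl (u t') x‖ ^ 2) *
                Real.sqrt (∫ x, frobeniusNormSq (fderiv ℝ (curl (u t')) x)) := by ring
        exact lt_of_le_of_lt key hstr
      have hcl := hX2 ν T hν hT u p hsol hLH hdec t' M ht'0 hM0 hT2 hMb hstr' hlock hgrad hheights t'' ⟨h1, h2'⟩
      -- `t'' ∈ F`: otherwise strict `m`-efficiency at `t''` contradicts the clause with `κ⋆ − ε ≤ m`
      have ht''0 : 0 ≤ t'' := by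
        have : 0 ≤ τ₁ * ν / M ^ 2 := by positivity
        linarith
      have ht''T : t'' < T := lt_of_le_of_lt h2' hT2
      show k t'' ≤ m
      by_contra hlt
      push Not at hlt
      obtain ⟨M', hM', hstr''⟩ := hkeff t'' ⟨ht''0, ht''T⟩ m hm0 hlt
      have hM'0 : 0 ≤ M' := (norm_nonneg _).trans (hM' 0)
      have hle := hcl M' hM'
      have hP' : 0 ≤ M' * Real.sqrt (∫ x, ‖curl (u t'') x‖ ^ 2) *
          Real.sqrt (∫ x, frobeniusNormSq (fderiv ℝ (curl (u t'')) x)) := by positivity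
      have hmono : (kStar - ε) * M' * Real.sqrt (∫ x, ‖curl (u t'') x‖ ^ 2) *
          Real.sqrt (∫ x, frobeniusNormSq (fderiv ℝ (curl (u t'')) x)) ≤
          m * M' * Real.sqrt (∫ x, ‖curl (u t'') x‖ ^ 2) *
          Real.sqrt (∫ x, frobeniusNormSq (fderiv ℝ (curl (u t'')) x)) := by
        have h := mul_le_mul_of_nonneg_right hmε hP'
        calc (kStar - ε) * M' * Real.sqrt (∫ x, ‖curl (u t'') x‖ ^ 2) *
              Real.sqrt (∫ x, frobeniusNormSq (fderiv ℝ (curl (u t'')) x))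
            = (kStar - ε) * (M' * Real.sqrt (∫ x, ‖curl (u t'') x‖ ^ 2) *
              Real.sqrt (∫ x, frobeniusNormSq (fderiv ℝ (curl (u t'')) x))) := by ring
          _ ≤ m * (M' * Real.sqrt (∫ x, ‖curl (u t'') x‖ ^ 2) *
              Real.sqrt (∫ x, frobeniusNormSq (fderiv ℝ (curl (u t'')) x))) := h
          _ = m * M' * Real.sqrt (∫ x, ‖curl (u t'') x‖ ^ 2) *
              Real.sqrt (∫ x, frobeniusNormSq (fderiv ℝ (curl (u t'')) x)) := by ring
      exact absurd (lt_of_lt_of_le hstr'' (hle.trans hmono)) (lt_irrefl _)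
  have hineq := hGap T t₁ t S {σ : ℝ | k σ ≤ m} ht₁t.le htT hSm hFm hSsub hSF hkill
  -- bookkeeping: `c·dℓ ≤ (cd/2)ℓ + C₀` and `ℓ ≥ 2C₀/(cd) + 1`
  have e1 : c * (d * Real.log ((T - t₁) / (T - t))) ≤
      c * (∫ τ in t₁..t, Set.indicator S (fun _ => (1 : ℝ)) τ / (T - τ)) := mul_le_mul_of_nonneg_left hSd hc.le
  have e2 : c * (d * Real.log ((T - t₁) / (T - t))) = 2 * (c * d / 2 * Real.log ((T - t₁) / (T - t))) := by ring
  have h2 : c * d / 2 * Real.log ((T - t₁) / (T - t)) ≤ C₀ := by linarith [e1, e2, hineq, hEc]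
  have h3 : Real.log ((T - t₁) / (T - t)) ≤ 2 * C₀ / (c * d) := by
    rw [le_div_iff₀ hcd]
    have e3 : Real.log ((T - t₁) / (T - t)) * (c * d) = 2 * (c * d / 2 * Real.log ((T - t₁) / (T - t))) := by ring
    linarith [h2, e3]
  linarith [h3, hL]

/-- Sanity: the registered stubs compose to the crux by name. -/
example : NearExtremalTransiencePerFlow :=
  NearExtremalTransiencePerFlow_of stub_nearExtremalExit

end Summit.NavierStokesRegularity.NavierStokesRegularity.Cruxes.NearExtremalTransiencePerFlow.TransienceExit

end
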